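import Summits.BirchSwinnertonDyer.BirchSwinnertonDyer.Theorems.SignedLowerHalvesSmallImageLowerHalfBothSignsLambdaLowerThreeNsThetaPartnerAssembly
import Summits.BirchSwinnertonDyer.BirchSwinnertonDyer.Theorems.SignedLowerHalvesSmallImageLowerHalfBothSignsLambdaLowerThreeNsThetaPartnerSansLevelOfR6
import HarnessLib

/-!
# K0₂′ — the ARITHMETIC HALF of every small-image X7 pair, EXPORTED: the Grössencharakter `ψ` of the inert shadow field `K` behind the
# Hecke theta partner `g = θ_ψ` (line `rtt_w3`, crux L `SmallImageLowerHalfBothSigns`, item stmt-BirchSwinnertonDyer-23599)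

LEAD `cruxlead-stmt-BirchSwinnertonDyer-23599` g3; helper `--supports stmt-BirchSwinnertonDyer-23599`; THEOREMS ONLY, no `sorry`; BSD is not proved here.

WHY. K0₂ (`stub_heckeThetaPartner_ns`, p741818) outputs the partner `(M, g, ι, Ω)` and FORGETS the Grössencharakter `ψ` (`g = θ_ψ`) that its
proof constructs (assembly `heckeThetaPartner_of_inertField` Steps 1–5, then the socket `heckeThetaPartner_of_arithmeticHalf`). The road of
record for the v6 engine stub `stub_existsPartnerSelmerBoundT3_ns` (census `Lines/rtt_w3-CENSUS-PSB-g3.md` §2/§6: E1 Shapiro transport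
`W ↔ ψ̄`, E2 signed main conjecture for `ψ` at the inert `p`) needs `ψ` itself. This file re-runs the same kernel proofs and stops BEFORE the
socket: `exists_arithmeticHalf_of_inertField` (R6's hypotheses ⟹ `(𝔪, ψ, σ')` with the socket's clauses; proof = Steps 1–5 VERBATIM) and ★
`exists_arithmeticHalf_classwide` (hypothesis-free on `p ≠ 2`, `ClassX7 W p`, `¬ Surj W p`: EXACTLY the hypothesis `hAH` of
`heckeThetaPartner_classwide_of_arithmeticHalf`, plus the inert place, the discriminant clauses and the small-image datum `(Φ, k, e₀)` with
`U = ρ̄⁻¹(Φ⁻¹(kˣ)) ≤ G_K`, `ρ̄(G_K) ⊆ kˣ`; proof = `heckeThetaPartner_sansLevel_of_R6` VERBATIM). K0₂ = socket ∘ (this file).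

References: [Serre1972] §2.2 Prop. 14, §4.2 c), §5.2 (iv); [Ribet1977Nebentypus] §3; [NeukirchANT1999] Ch. VII §6 (6.14), Ch. VI.
-/

set_option autoImplicit false
set_option linter.dupNamespace false
noncomputable section

open scoped Classical NumberField MatrixGroups nonZeroDivisors
open IsDedekindDomain IsDedekindDomain.HeightOneSpectrum Field Matrix NumberField WeierstrassCurve
  Literature.NumberTheory.EllipticCurves Literature.NumberTheory.GaloisRepresentations Rat.HeightOneSpectrum
  Literature.NumberTheory.EllipticCurves.Rank1Residual Summit.BirchSwinnertonDyer.Rank1Residual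
  Literature.NumberTheory.LFunctions Literature.NumberTheory.GaloisRepresentations.HeckeCharacter
  Literature.NumberTheory.GaloisRepresentations.IsNonarchimedeanLocalField
  Literature.NumberTheory.GaloisRepresentations.ModPGaloisRep ValuativeRel
  Literature.NumberTheory.EllipticCurves.ModularForms Literature.NumberTheory.Automorphic
  Summit.BirchSwinnertonDyer.BirchSwinnertonDyer.Theorems.HeckeThetaPartner

namespace Summit.BirchSwinnertonDyer.BirchSwinnertonDyer.Theorems.SmallImageLambdaLowerThreeNsThetaPartner

section InertField

variable (W : WeierstrassCurve ℚ) [W.IsElliptic] [W.IsGloballyMinimal] (p : ℕ) [Fact p.Prime]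
  (Φ : Multiplicative (AddAut (geomTorsion W p)) ≃* GL (Fin 2) (ZMod p))
  {k : Subalgebra (ZMod p) (Matrix (Fin 2) (Fin 2) (ZMod p))}
  (K : Type) [Field K] [NumberField K] [IsGalois ℚ K] [IsTotallyComplex K]

set_option maxHeartbeats 800000 in
/-- **The arithmetic half from the inert field** (R6 Steps 1–5 with the Grössencharakter EXPORTED instead of fed to the socket): a modulus
`𝔪 = (t)`, a Grössencharakter `ψ mod 𝔪` of type `σ'` and the clauses of `heckeThetaPartner_of_arithmeticHalf`.
[cite: Serre1972, §2.2, §4.2] [cite: Ribet1977Nebentypus, §3 Thm. 3.6] [cite: NeukirchANT1999, Ch. VII §6 (6.14)] -/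
theorem exists_arithmeticHalf_of_inertField (hp2 : p ≠ 2) (hss : GoodSS W p)
    (e₀ : geomTorsion W p ≃+ (Fin 2 → ZMod p))
    (he₀ : ∀ (g : Multiplicative (AddAut (geomTorsion W p))) (x : geomTorsion W p),
      e₀ (Multiplicative.toAdd g x) = ((Φ g : GL (Fin 2) (ZMod p)) : Matrix (Fin 2) (Fin 2) (ZMod p)) *ᵥ e₀ x)
    (hk : IsField k) (h2 : Module.finrank (ZMod p) k = 2)
    (htr : letI : Module (ZMod p) (geomTorsion W p) := AddSubgroup.torsionBy.zmodModule
      ∀ g : Multiplicative (AddAut (geomTorsion W p)),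
        Matrix.trace ((Φ g : GL (Fin 2) (ZMod p)) : Matrix (Fin 2) (Fin 2) (ZMod p)) =
          LinearMap.trace (ZMod p) (geomTorsion W p) ((Multiplicative.toAdd g).toAddMonoidHom.toZModLinearMap p))
    (hGN : (galoisRepTorsion W p).range.map Φ.toMonoidHom ≤
      Subgroup.normalizer (Serre1972.unitGroup k : Set (GL (Fin 2) (ZMod p))))
    (hK2 : Module.finrank ℚ K = 2)
    (hU : ((Serre1972.unitGroup k).comap Φ.toMonoidHom).comap (galoisRepTorsion W p) ≤
      (absGaloisRestrict ℚ K).toMonoidHom.range)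
    (hKU : ∀ τ : absoluteGaloisGroup K,
      Φ (galoisRepTorsion W p (absGaloisRestrict ℚ K τ)) ∈ Serre1972.unitGroup k)
    {v : HeightOneSpectrum (𝓞 K)} (hvp : v.asIdeal = Ideal.span {(p : 𝓞 K)})
    (hgen : ∀ c ∈ IsLocalRing.maximalIdeal (v.adicCompletionIntegers K),
      ((p : ℕ) : v.adicCompletionIntegers K) ∣ c)
    (hπ : (valuation (v.adicCompletion K)).IsUniformizer ((p : ℕ) : v.adicCompletion K))
    (hq : residueFieldCard (v.adicCompletion K) = p ^ 2) (hcard : Nat.card (𝓞 K ⧸ v.asIdeal) = p ^ 2)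
    (ι : absIntegers 𝒪[v.adicCompletion K] (v.adicCompletion K) ⧸ absMaximalIdeal (v.adicCompletion K) →+*
      padicAlgClResidueField p)
    (c : K →+* K) (cO : 𝓞 K →+* 𝓞 K) (hcO : ∀ b : 𝓞 K, ((cO b : 𝓞 K) : K) = c (b : K))
    (hc : ∀ b : 𝓞 K, cO b - b ^ p ∈ v.asIdeal)
    {δ : 𝓞 K} {Δ : ℤ} (hΔ : Δ < 0) (hδ : (δ : K) ^ 2 = (Δ : K))
    (hd4 : NumberField.discr K % 4 = 0 ∨ NumberField.discr K % 4 = 1) (hpd : ¬ (p : ℤ) ∣ NumberField.discr K)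
    (hdK : ∀ (ℓ : ℕ) [Fact ℓ.Prime], (ℓ : ℤ) ∣ NumberField.discr K → ¬ W.HasGoodReductionAtPrime ℓ)
    (B : ℕ) (hB0 : B ≠ 0) (hpB : ¬ p ∣ B) (hBbad : ∀ (ℓ : ℕ) [Fact ℓ.Prime], ℓ ∣ B → ¬ W.HasGoodReductionAtPrime ℓ)
    (hbadB : ∀ (ℓ : ℕ) [Fact ℓ.Prime], ¬ W.HasGoodReductionAtPrime ℓ → ℓ ∣ B)
    (e : PadicAlgCl p ≃+* ℂ) (σ : K →+* ℂ) :
    ∃ (𝔪 : Ideal (𝓞 K)) (ψ : HeightOneSpectrum (𝓞 K) → ℂ) (σ' : K →+* ℂ),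
      𝔪 ≠ ⊥ ∧ (∀ I : Ideal (𝓞 K), Ideal.absNorm I ≠ p) ∧ ¬ p ∣ (NumberField.discr K).natAbs * Ideal.absNorm 𝔪 ∧
      (∀ (ℓ : ℕ) [Fact ℓ.Prime], ℓ ∣ (NumberField.discr K).natAbs * Ideal.absNorm 𝔪 → ¬ W.HasGoodReductionAtPrime ℓ) ∧
      IsGrossencharakter 𝔪 (embType σ') (embTypeConj σ') ψ ∧
      (∀ n : ℕ, Odd n → n.Coprime ((NumberField.discr K).natAbs * Ideal.absNorm 𝔪) →
        idealPow K ψ (Ideal.span {(n : 𝓞 K)}) = (jacobiSym (NumberField.discr K) n : ℂ) * (n : ℂ) ^ (2 - 1)) ∧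
      (∀ (ℓ : ℕ) [Fact ℓ.Prime], ℓ ≠ p → W.HasGoodReductionAtPrime ℓ →
        ‖e.symm (∑ᶠ (w : HeightOneSpectrum (𝓞 K)) (_ : Ideal.absNorm w.asIdeal = ℓ), ψ w) -
          (W.frobeniusTrace ℓ : PadicAlgCl p)‖ < 1) := by
  have hp : p.Prime := Fact.out
  have hpv : (p : 𝓞 K) ∈ v.asIdeal := by rw [hvp]; exact Ideal.mem_span_singleton_self _
  have hpPrime : (Ideal.span {(p : 𝓞 K)}).IsPrime := hvp ▸ v.isPrime
  have hUK : ∀ τ : absoluteGaloisGroup ℚ,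
      Φ (galoisRepTorsion W p τ) ∈ Serre1972.unitGroup k → τ ∈ (absGaloisRestrict ℚ K).range := by
    intro τ hτ
    obtain ⟨x, hx⟩ := hU (show τ ∈ ((Serre1972.unitGroup k).comap Φ.toMonoidHom).comap (galoisRepTorsion W p)
      from hτ)
    exact ⟨x, hx⟩
  have hπ₀ : (valuation (v.adicCompletion K)).IsUniformizer
      ((((p : ℕ) : 𝒪[v.adicCompletion K]) : 𝒪[v.adicCompletion K]) : v.adicCompletion K) := by
    simpa using hπ
  /- Step 1: ORIENT-CFT -/
  obtain ⟨j, Tz, χA, η, hTz, hjpow, -, hunrχ, hfin, hram, hFrob, hloc⟩ :=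
    exists_heckeCharacter_localComponent_eq W p Φ hp2 hss e₀ he₀ hk h2 hGN K hU hKU hpv hgen hπ₀ hq ι e
  /- Step 2: a module of definition of `η` containing `v`, and the integer `t` -/
  obtain ⟨eM, hmod0⟩ := exists_isModulus_of_ramified η
  set T : Finset (HeightOneSpectrum (𝓞 K)) := insert v (finite_ramifiedPlaces_holds η).toFinset with hTdef
  have hmod : IsModulus η T eM :=
    hmod0.of_isUnramifiedAt fun w hw hwT => absurd (Finset.mem_insert_of_mem hw) hwT
  have hvT : v ∈ T := Finset.mem_insert_self _ _
  set m : ℕ := 1 + T.sum eM with hmdef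
  set t : ℤ := NumberField.discr K * (B : ℤ) ^ m with htdef
  have hd0 : NumberField.discr K ≠ 0 := NumberField.discr_ne_zero K
  have ht0 : t ≠ 0 := mul_ne_zero hd0 (pow_ne_zero _ (by exact_mod_cast hB0))
  have hdt : NumberField.discr K ∣ t := Dvd.intro _ rfl
  have hd3 : 2 < |NumberField.discr K| := NumberField.abs_discr_gt_two (by rw [hK2]; norm_num)
  have ht3 : 3 ≤ |t| := by
    rw [htdef, abs_mul, abs_pow, Nat.abs_cast]
    have h1 : (1 : ℤ) ≤ (B : ℤ) ^ m := one_le_pow₀ (by exact_mod_cast Nat.one_le_iff_ne_zero.mpr hB0)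
    nlinarith
  have hptZ : ¬ (p : ℤ) ∣ t := by
    intro h
    rcases (Int.Prime.dvd_mul' hp h) with h1 | h1
    · exact hpd h1
    · exact hpB (Int.natCast_dvd_natCast.mp (Int.Prime.dvd_pow' hp h1))
  have hpt : (t : 𝓞 K) ∉ Ideal.span {(p : 𝓞 K)} := fun h => hptZ (natCast_dvd_of_intCast_mem_span hp h)
  -- the prime factors of `t` are bad
  have htbad : ∀ (ℓ : ℕ) [Fact ℓ.Prime], (ℓ : ℤ) ∣ t → ¬ W.HasGoodReductionAtPrime ℓ := by
    intro ℓ _ hℓt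
    have hℓ : ℓ.Prime := Fact.out
    rcases Int.Prime.dvd_mul' hℓ hℓt with h1 | h1
    · exact hdK ℓ h1
    · exact hBbad ℓ (Int.natCast_dvd_natCast.mp (Int.Prime.dvd_pow' hℓ h1))
  have hgood_of : ∀ (ℓ : ℕ) [Fact ℓ.Prime], ¬ (ℓ : ℤ) ∣ t → W.HasGoodReductionAtPrime ℓ := by
    intro ℓ _ hℓt
    by_contra hbad
    exact hℓt ((Int.natCast_dvd_natCast.mpr (hbadB ℓ hbad)).trans
      ((dvd_pow_self (B : ℤ) (by omega)).trans (Dvd.intro_left _ rfl)))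
  -- `(t) ≤ w^{e_w + 1}` at the places `w ≠ v` of `T`
  have hTw : ∀ w ∈ T, w ≠ v → (t : 𝓞 K) ∈ w.asIdeal ^ (eM w + 1) := by
    intro w hw hwv
    have hw' : w ∈ (finite_ramifiedPlaces_holds η).toFinset := by
      rcases Finset.mem_insert.mp hw with h | h
      · exact absurd h hwv
      · exact h
    have hram_w : ¬ η.IsUnramifiedAt w := (Set.Finite.mem_toFinset _).mp hw'
    have hχram : ¬ χA.IsUnramifiedAt w := fun h => hram_w ((hram w).mpr h)
    -- the rational prime under `w`
    set ℓ : ℕ := (primesEquiv (w.under (𝓞 ℚ)) : ℕ) with hℓdef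
    haveI : Fact ℓ.Prime := ⟨(primesEquiv (w.under (𝓞 ℚ))).2⟩
    have hℓw : (ℓ : 𝓞 K) ∈ w.asIdeal := (under_eq_iff_natCast_primesEquiv_mem w (w.under (𝓞 ℚ))).mp rfl
    have hℓp : ℓ ≠ p := by
      intro h
      apply hwv
      have hle : v.asIdeal ≤ w.asIdeal := by
        rw [hvp, Ideal.span_singleton_le_iff_mem, ← h]; exact hℓw
      exact HeightOneSpectrum.ext (v.isMaximal.eq_of_le w.isPrime.ne_top hle).symm
    have hbad : ¬ W.HasGoodReductionAtPrime ℓ := fun hgood => hχram (hunrχ ℓ hℓp hgood w hℓw)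
    have hℓB : ℓ ∣ B := hbadB ℓ hbad
    have hBw : (B : 𝓞 K) ∈ w.asIdeal := by
      obtain ⟨r, hr⟩ := hℓB
      rw [hr, Nat.cast_mul]; exact w.asIdeal.mul_mem_right _ hℓw
    have hm : eM w + 1 ≤ m := by
      have h1 : eM w ≤ T.sum eM := Finset.single_le_sum (f := eM) (fun _ _ => Nat.zero_le _) hw
      rw [hmdef]; omega
    have h1 : ((B : ℤ) ^ m : ℤ) = (((B ^ m : ℕ) : ℤ)) := by push_cast; rfl
    rw [htdef, Int.cast_mul, Int.cast_pow, Int.cast_natCast]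
    exact Ideal.mul_mem_left _ _ (Ideal.pow_le_pow_right hm (Ideal.pow_mem_pow hBw m))
  /- Step 3: MATCHING -/
  obtain ⟨R, hR, hRv, -⟩ := exists_ringHom_residue_local (K := K) (p := p) v hvp hπ hcard ι
  obtain ⟨σ', -, hGR⟩ := exists_embedding_residue_eq (K := K) (p := p) v hvp hcard c cO hcO hc e σ R hRv
  obtain ⟨G, hG, -⟩ := exists_ringHom_residue_embedding (K := K) (p := p) e σ'
  have hσ' : ∀ b : 𝓞 K, IsLocalRing.residue (padicAlgClIntegers p)
      ⟨e.symm (σ' (b : K)), (padicAlgCl_mem_valuationSubring_iff p _).mpr (norm_symm_embedding_le_one e σ' b)⟩ =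
      ι (residue (v.adicCompletion K)
        (algebraMap (v.adicCompletion K) (AlgebraicClosure (v.adicCompletion K))
          (algebraMap (𝓞 K) (v.adicCompletion K) b))) := by
    intro b
    rw [← hG b, hGR G hG b, hR b]
  have hM : ∀ b : 𝓞 K, b ≠ 0 → b ∉ Ideal.span {(p : 𝓞 K)} → b - 1 ∈ Ideal.span {(t : 𝓞 K)} →
      ‖e.symm (idealPow K (fun w => η.valueAtUniformizer w) (Ideal.span {b})) - e.symm (σ' (b : K))‖ < 1 := by
    intro b hb hbp hb1
    refine norm_idealPow_sub_embedding_lt_one (K := K) (p := p) v hvp hπ hcard ι e σ' hσ' Tz hTz hfin hmod hvT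
      hloc hb (by rwa [hvp]) fun w hw hwv => ?_
    obtain ⟨r, hr⟩ := Ideal.mem_span_singleton'.mp hb1
    rw [← hr]
    exact Ideal.mul_mem_left _ _ (hTw w hw hwv)
  /- Step 4: TWIST -/
  obtain ⟨lam, ψ₀, ψ, hC1, hC2, hψG, hC4, hC5⟩ :=
    exists_grossencharakter_twist (K := K) (p := p) hK2 hpPrime hΔ hδ e σ' hfin ht3 hdt hpt hM
  /- Step 5: the socket's hypotheses -/
  have h𝔪 : Ideal.span {(t : 𝓞 K)} ≠ ⊥ := by
    rw [Ne, Ideal.span_singleton_eq_bot]; exact_mod_cast ht0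
  have hN𝔪 : Ideal.absNorm (Ideal.span {(t : 𝓞 K)}) = t.natAbs ^ 2 := absNorm_span_intCast hK2 t
  have hnop : ∀ I : Ideal (𝓞 K), Ideal.absNorm I ≠ p := absNorm_ne_of_inert hp hvp hcard
  have hpD : ¬ p ∣ (NumberField.discr K).natAbs * Ideal.absNorm (Ideal.span {(t : 𝓞 K)}) := by
    rw [hN𝔪]
    intro h
    rcases (Nat.Prime.dvd_mul hp).mp h with h1 | h1
    · exact hpd (Int.natCast_dvd.mpr h1)
    · exact hptZ (Int.natCast_dvd.mpr (Nat.Prime.dvd_of_dvd_pow hp h1))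
  have hbad : ∀ (ℓ : ℕ) [Fact ℓ.Prime], ℓ ∣ (NumberField.discr K).natAbs * Ideal.absNorm (Ideal.span {(t : 𝓞 K)}) →
      ¬ W.HasGoodReductionAtPrime ℓ := by
    intro ℓ _ h
    have hℓ : ℓ.Prime := Fact.out
    rw [hN𝔪] at h
    rcases (Nat.Prime.dvd_mul hℓ).mp h with h1 | h1
    · exact hdK ℓ (Int.natCast_dvd.mpr h1)
    · exact htbad ℓ (Int.natCast_dvd.mpr (Nat.Prime.dvd_of_dvd_pow hℓ h1))
  -- places above a good prime: neither above `p` nor above `t`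
  have hwp : ∀ (ℓ : ℕ), ℓ.Prime → ℓ ≠ p → ∀ w : HeightOneSpectrum (𝓞 K), (ℓ : 𝓞 K) ∈ w.asIdeal →
      ¬ Ideal.span {(p : 𝓞 K)} ≤ w.asIdeal := by
    intro ℓ hℓ hℓp w hℓw hle
    have hpw : (p : 𝓞 K) ∈ w.asIdeal := hle (Ideal.mem_span_singleton_self _)
    have hcop : IsCoprime (ℓ : ℤ) (p : ℤ) := by
      rw [Nat.isCoprime_iff_coprime]; exact (Nat.coprime_primes hℓ hp).mpr hℓp
    obtain ⟨a, b, hab⟩ := hcop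
    have h1 : (1 : 𝓞 K) ∈ w.asIdeal := by
      have := congrArg (Int.cast : ℤ → 𝓞 K) hab
      push_cast at this
      rw [← this]
      exact w.asIdeal.add_mem (w.asIdeal.mul_mem_left _ hℓw) (w.asIdeal.mul_mem_left _ hpw)
    exact w.isPrime.ne_top ((Ideal.eq_top_iff_one _).mpr h1)
  have hwt : ∀ (ℓ : ℕ), ℓ.Prime → ¬ (ℓ : ℤ) ∣ t → ∀ w : HeightOneSpectrum (𝓞 K), (ℓ : 𝓞 K) ∈ w.asIdeal →
      ¬ Ideal.span {(t : 𝓞 K)} ≤ w.asIdeal := by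
    intro ℓ hℓ hℓt w hℓw hle
    have htw : (t : 𝓞 K) ∈ w.asIdeal := hle (Ideal.mem_span_singleton_self _)
    have hcop : IsCoprime (ℓ : ℤ) t := (Int.isCoprime_iff_gcd_eq_one.mpr (by
      rw [Int.gcd_eq_natAbs, Int.natAbs_natCast]
      exact (Nat.Prime.coprime_iff_not_dvd hℓ).mpr fun h => hℓt (Int.natCast_dvd.mpr h)))
    obtain ⟨a, b, hab⟩ := hcop
    have h1 : (1 : 𝓞 K) ∈ w.asIdeal := by
      have := congrArg (Int.cast : ℤ → 𝓞 K) hab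
      push_cast at this
      rw [← this]
      exact w.asIdeal.add_mem (w.asIdeal.mul_mem_left _ hℓw) (w.asIdeal.mul_mem_left _ htw)
    exact w.isPrime.ne_top ((Ideal.eq_top_iff_one _).mpr h1)
  -- the Frobenius values of `η` at the places above a good `ℓ ≠ p`
  have hχv : ∀ (ℓ : ℕ) [Fact ℓ.Prime], ℓ ≠ p → W.HasGoodReductionAtPrime ℓ →
      ∀ w : HeightOneSpectrum (𝓞 K), (ℓ : 𝓞 K) ∈ w.asIdeal →
        ∀ 𝔔 ∈ w.primesAbove, ∀ F : absoluteGaloisGroup K, IsArithFrobAt (𝓞 K) F 𝔔 →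
          (fun w => η.valueAtUniformizer w) w =
            e (Tz (j ⟨(Φ (galoisRepTorsion W p (absGaloisRestrict ℚ K F)) : Matrix (Fin 2) (Fin 2) (ZMod p)),
              hKU F⟩)) := by
    intro ℓ _ hℓp hgood w hℓw 𝔔 h𝔔 F hF
    exact hFrob w (hunrχ ℓ hℓp hgood w hℓw) 𝔔 h𝔔 F hF
  have hneb : ∀ n : ℕ, Odd n → n.Coprime ((NumberField.discr K).natAbs * Ideal.absNorm (Ideal.span {(t : 𝓞 K)})) →
      idealPow K ψ (Ideal.span {(n : 𝓞 K)}) = (jacobiSym (NumberField.discr K) n : ℂ) * (n : ℂ) ^ (2 - 1) := by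
    intro n hn hcop
    have hcop' : n.Coprime t.natAbs := by
      rw [hN𝔪] at hcop
      exact Nat.Coprime.coprime_dvd_right ⟨(NumberField.discr K).natAbs * t.natAbs, by ring⟩ hcop
    refine idealPow_natCast_eq_jacobiSym_mul_of_twist (K := K) (p := p) hp2 e σ' hd4 hdt hptZ hC1 hC2 hψG hC5
      (fun ℓ hℓ hℓp hℓ2 hℓt => ?_) n hn hcop'
    haveI : Fact ℓ.Prime := ⟨hℓ⟩
    have hgood := hgood_of ℓ hℓt
    have hℓd : ¬ (ℓ : ℤ) ∣ NumberField.discr K := fun h => hℓt (h.trans hdt)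
    set u : HeightOneSpectrum (𝓞 ℚ) := (primesEquiv (R := 𝓞 ℚ)).symm ⟨ℓ, hℓ⟩ with hu
    have hu' : (primesEquiv u : ℕ) = ℓ := by
      rw [hu, Equiv.apply_symm_apply]
    exact norm_symm_idealPow_span_prime_sub_lt_one W p Φ K hk h2 e₀ he₀ hGN hK2 hKU hUK j e Tz hTz hjpow
      (fun w => η.valueAtUniformizer w) hℓp hℓ2 hgood hu' hℓd (hχv ℓ hℓp hgood)
  have htrace : ∀ (ℓ : ℕ) [Fact ℓ.Prime], ℓ ≠ p → W.HasGoodReductionAtPrime ℓ →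
      ‖e.symm (∑ᶠ (w : HeightOneSpectrum (𝓞 K)) (_ : Ideal.absNorm w.asIdeal = ℓ), ψ w) -
        (W.frobeniusTrace ℓ : PadicAlgCl p)‖ < 1 := by
    intro ℓ _ hℓp hgood
    have hℓ : ℓ.Prime := Fact.out
    have hℓd : ¬ (ℓ : ℤ) ∣ NumberField.discr K := fun h => hdK ℓ h hgood
    have hℓt : ¬ (ℓ : ℤ) ∣ t := fun h => htbad ℓ h hgood
    set u : HeightOneSpectrum (𝓞 ℚ) := (primesEquiv (R := 𝓞 ℚ)).symm ⟨ℓ, hℓ⟩ with hu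
    have hu' : (primesEquiv u : ℕ) = ℓ := by
      rw [hu, Equiv.apply_symm_apply]
    refine norm_finsum_sub_frobeniusTrace_lt_one W p Φ K hk h2 htr hGN hK2 hKU hUK j e Tz hTz hjpow
      (fun w => η.valueAtUniformizer w) ψ hℓp hgood hu' (isUnramifiedIn_asIdeal_of_not_dvd_discr hu' hℓd)
      (hχv ℓ hℓp hgood) fun w hℓw => hC4 w (hwp ℓ hℓ hℓp w hℓw) (hwt ℓ hℓ hℓt w hℓw)
  /- Step 6: EXPORT the arithmetic half (no socket) -/
  exact ⟨Ideal.span {(t : 𝓞 K)}, ψ, σ', h𝔪, hnop, hpD, fun ℓ _ h => hbad ℓ h, hψG, hneb, fun ℓ _ hℓp hgood => htrace ℓ hℓp hgood⟩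

end InertField

/-- ★ **Every small-image X7 pair carries an ARITHMETIC HALF (class-wide, hypothesis-free): the Grössencharakter behind the Hecke theta
partner, EXPORTED.** For `W/ℚ` globally minimal, `p ≠ 2`, `ClassX7 W p`, `ρ̄_{W,p}` not onto: an imaginary quadratic `K` (the shadow field
`ℚ̄^U`, `U = ρ̄⁻¹(Φ⁻¹(kˣ))` of index `2`; the datum `Φ, k, e₀` with `ρ̄(G_K) ⊆ kˣ`, `U ≤ G_K` is exported) in which `p` is INERT (`v = (p)`,
`#𝓞_K/v = p²`, no ideal of norm `p`, `p ∤ d_K`, primes of `d_K` bad), `σ : K → ℂ`, a modulus `𝔪 ≠ 0` (`p ∤ |d_K|·N𝔪`, prime factors bad),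
`e : ℚ̄_p ≃ ℂ` and a Grössencharakter `ψ mod 𝔪` of type `σ` with trivial Nebentypus whose prime sums are congruent to `a_ℓ(W)` along `e` at
every good `ℓ ≠ p` — EXACTLY the hypothesis `hAH` of `heckeThetaPartner_classwide_of_arithmeticHalf` (output: K0₂'s `g = θ_ψ`), plus the
inert/discriminant/small-image clauses. Proof = `heckeThetaPartner_sansLevel_of_R6` VERBATIM with the last line replaced by
`exists_arithmeticHalf_of_inertField`. [cite: Serre1972, §2.2 Prop. 14, §4.2 c), §5.2 (iv)] [cite: Ribet1977Nebentypus, §3 Thm. 3.6]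
[cite: NeukirchANT1999, Ch. VII §6 (6.14)] -/
theorem exists_arithmeticHalf_classwide (W : WeierstrassCurve ℚ) [W.IsElliptic] [W.IsGloballyMinimal] (p : ℕ) [Fact p.Prime]
    (hp2 : p ≠ 2) (hX : ClassX7 W p) (hs : ¬ Surj W p) :
    ∃ (K : Type) (_ : Field K) (_ : NumberField K) (σ : K →+* ℂ) (𝔪 : Ideal (𝓞 K))
      (ψ : HeightOneSpectrum (𝓞 K) → ℂ) (e : PadicAlgCl p ≃+* ℂ),
      Module.finrank ℚ K = 2 ∧ IsTotallyComplex K ∧ 𝔪 ≠ ⊥ ∧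
      (∀ I : Ideal (𝓞 K), Ideal.absNorm I ≠ p) ∧ ¬ p ∣ (NumberField.discr K).natAbs * Ideal.absNorm 𝔪 ∧
      (∀ (ℓ : ℕ) [Fact ℓ.Prime], ℓ ∣ (NumberField.discr K).natAbs * Ideal.absNorm 𝔪 → ¬ W.HasGoodReductionAtPrime ℓ) ∧
      IsGrossencharakter 𝔪 (embType σ) (embTypeConj σ) ψ ∧
      (∀ n : ℕ, Odd n → n.Coprime ((NumberField.discr K).natAbs * Ideal.absNorm 𝔪) →
        idealPow K ψ (Ideal.span {(n : 𝓞 K)}) = (jacobiSym (NumberField.discr K) n : ℂ) * (n : ℂ) ^ (2 - 1)) ∧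
      (∀ (ℓ : ℕ) [Fact ℓ.Prime], ℓ ≠ p → W.HasGoodReductionAtPrime ℓ →
        ‖e.symm (∑ᶠ (w : HeightOneSpectrum (𝓞 K)) (_ : Ideal.absNorm w.asIdeal = ℓ), ψ w) -
          (W.frobeniusTrace ℓ : PadicAlgCl p)‖ < 1) ∧
      (∃ v : HeightOneSpectrum (𝓞 K), v.asIdeal = Ideal.span {(p : 𝓞 K)} ∧ Nat.card (𝓞 K ⧸ v.asIdeal) = p ^ 2) ∧
      ¬ (p : ℤ) ∣ NumberField.discr K ∧
      (∀ (ℓ : ℕ) [Fact ℓ.Prime], (ℓ : ℤ) ∣ NumberField.discr K → ¬ W.HasGoodReductionAtPrime ℓ) ∧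
      ∃ (Φ : Multiplicative (AddAut (geomTorsion W p)) ≃* GL (Fin 2) (ZMod p))
        (k : Subalgebra (ZMod p) (Matrix (Fin 2) (Fin 2) (ZMod p))) (e₀ : geomTorsion W p ≃+ (Fin 2 → ZMod p)),
        (∀ (g : Multiplicative (AddAut (geomTorsion W p))) (x : geomTorsion W p),
          e₀ (Multiplicative.toAdd g x) = ((Φ g : GL (Fin 2) (ZMod p)) : Matrix (Fin 2) (Fin 2) (ZMod p)) *ᵥ e₀ x) ∧
        IsField k ∧ Module.finrank (ZMod p) k = 2 ∧
        (letI : Module (ZMod p) (geomTorsion W p) := AddSubgroup.torsionBy.zmodModule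
          ∀ g : Multiplicative (AddAut (geomTorsion W p)),
            Matrix.trace ((Φ g : GL (Fin 2) (ZMod p)) : Matrix (Fin 2) (Fin 2) (ZMod p)) =
              LinearMap.trace (ZMod p) (geomTorsion W p) ((Multiplicative.toAdd g).toAddMonoidHom.toZModLinearMap p)) ∧
        (galoisRepTorsion W p).range.map Φ.toMonoidHom ≤
          Subgroup.normalizer (Serre1972.unitGroup k : Set (GL (Fin 2) (ZMod p))) ∧
        ((Serre1972.unitGroup k).comap Φ.toMonoidHom).comap (galoisRepTorsion W p) ≤
          (absGaloisRestrict ℚ K).toMonoidHom.range ∧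
        (∀ τ : absoluteGaloisGroup K, Φ (galoisRepTorsion W p (absGaloisRestrict ℚ K τ)) ∈ Serre1972.unitGroup k) := by
  classical
  have hp : p.Prime := Fact.out
  have hss : GoodSS W p := hX.1
  -- frame and small-image datum (Serre 1972 §2, §5.2 (iv); `…KobayashiMainConjectureSmallImageShadowInert`)
  obtain ⟨e₀, Φ, he₀, htr, -⟩ := exists_frame_galoisRepTorsion_rat W p
  obtain ⟨k, hk, h2, hGN, hopen, hidx, hin, himag, hinert⟩ :=
    smallImage_exists_imaginary_inert_index_two_subgroup_of_goodSS_of_not_surj W p Φ e₀ he₀ hp2 hss hs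
  set U : Subgroup (absoluteGaloisGroup ℚ) :=
    ((Serre1972.unitGroup k).comap Φ.toMonoidHom).comap (galoisRepTorsion W p) with hU
  -- AH1a: the dihedral field `K = ℚ̄^U`
  obtain ⟨K, _, _, hGal, htc, hK2, hrange, hunrK⟩ := exists_numberField_of_index_two U hopen hidx himag
  haveI := hGal
  haveI := htc
  have hUle : U ≤ (absGaloisRestrict ℚ K).toMonoidHom.range := by
    intro x hx
    rw [← hrange] at hx
    obtain ⟨τ, hτ⟩ := hx
    exact ⟨τ, hτ⟩
  have hKU : ∀ τ : absoluteGaloisGroup K, Φ (galoisRepTorsion W p (absGaloisRestrict ℚ K τ)) ∈ Serre1972.unitGroup k := by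
    intro τ
    have hτ : absGaloisRestrict ℚ K τ ∈ U := hrange ▸ ⟨τ, rfl⟩
    exact hτ
  -- the place of `ℚ` at `p`, unramified in `K`
  set v₀ : HeightOneSpectrum (𝓞 ℚ) := (primesEquiv (R := 𝓞 ℚ)).symm ⟨p, hp⟩ with hv₀
  have hpv₀' : natGenerator v₀ = p := congrArg Subtype.val ((primesEquiv (R := 𝓞 ℚ)).apply_symm_apply ⟨p, hp⟩)
  have hpv₀ : (p : 𝓞 ℚ) ∈ v₀.asIdeal := (Rat.natCast_mem_asIdeal_iff v₀).mpr (hpv₀' ▸ dvd_rfl)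
  have hunr : Algebra.IsUnramifiedIn (𝓞 K) v₀.asIdeal := hunrK v₀ fun 𝔓 h𝔓 => hin v₀ (Or.inl hpv₀) 𝔓 h𝔓
  -- AH1b: the inert place `v = p𝓞_K` and its local data
  obtain ⟨v, hvp, hcard⟩ := exists_place_asIdeal_eq_span K hK2 p hpv₀ hunr
    (fun 𝔓 h𝔓 => hrange.symm ▸ hin v₀ (Or.inl hpv₀) 𝔓 h𝔓)
    (fun 𝔓 h𝔓 σ hσ => hrange.symm ▸ hinert v₀ hpv₀ 𝔓 h𝔓 σ hσ)
  have hgen := natCast_dvd_of_mem_maximalIdeal hvp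
  have hπ := isUniformizer_natCast hvp
  have hq : residueFieldCard (v.adicCompletion K) = p ^ 2 := residueFieldCard_eq_of_card_quotient hcard
  -- AH1c: residue embedding, Frobenius, discriminant
  obtain ⟨ι⟩ := nonempty_residueEmbedding p v hq
  obtain ⟨c, cO, hcO, hc⟩ := exists_frobenius_ringHom K p hvp
  obtain ⟨t, m, δ, -, hδ⟩ := Literature.NumberTheory.QuadraticFields.Quadratic.exists_sq_eq_discr (K := K) hK2
  have hδ' : (δ : K) ^ 2 = ((NumberField.discr K : ℤ) : K) := by
    have h := congrArg (algebraMap (𝓞 K) K) hδ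
    rwa [map_pow, map_intCast] at h
  have hΔ : NumberField.discr K < 0 := by
    have h1 : InfinitePlace.nrComplexPlaces K = 1 := by
      have := IsTotallyComplex.finrank K
      omega
    have h := NumberField.sign_discr K
    rw [h1, pow_one] at h
    exact Int.sign_eq_neg_one_iff_neg.mp h
  have hd4 := Literature.NumberTheory.QuadraticFields.Quadratic.discr_emod_four (K := K) hK2
  have hpd : ¬ (p : ℤ) ∣ NumberField.discr K := not_dvd_discr_of_isUnramifiedIn K hp hpv₀ hunr
  have hdK : ∀ (ℓ : ℕ) [Fact ℓ.Prime], (ℓ : ℤ) ∣ NumberField.discr K → ¬ W.HasGoodReductionAtPrime ℓ := by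
    intro ℓ _ hℓd hgood
    have hℓ : ℓ.Prime := Fact.out
    set vℓ : HeightOneSpectrum (𝓞 ℚ) := (primesEquiv (R := 𝓞 ℚ)).symm ⟨ℓ, hℓ⟩ with hvℓ
    have hℓv' : natGenerator vℓ = ℓ := congrArg Subtype.val ((primesEquiv (R := 𝓞 ℚ)).apply_symm_apply ⟨ℓ, hℓ⟩)
    have hℓv : (ℓ : 𝓞 ℚ) ∈ vℓ.asIdeal := (Rat.natCast_mem_asIdeal_iff vℓ).mpr (hℓv' ▸ dvd_rfl)
    have hgood' : W.HasGoodReductionAt vℓ := W.hasGoodReductionAt_of_hasGoodReductionAtPrime vℓ hℓv hgood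
    have hunrℓ : Algebra.IsUnramifiedIn (𝓞 K) vℓ.asIdeal :=
      hunrK vℓ fun 𝔓 h𝔓 => hin vℓ (Or.inr (Or.inl hgood')) 𝔓 h𝔓
    exact not_dvd_discr_of_isUnramifiedIn K hℓ hℓv hunrℓ hℓd
  -- `B = N_W`
  have hB0 : W.conductorNorm ℤ ≠ 0 := (W.conductorNorm_pos_holds).ne'
  have hpB : ¬ p ∣ W.conductorNorm ℤ := fun h =>
    (W.dvd_conductorNorm_iff_not_hasGoodReductionAtPrime p).mp h hX.1.1
  have hBbad : ∀ (ℓ : ℕ) [Fact ℓ.Prime], ℓ ∣ W.conductorNorm ℤ → ¬ W.HasGoodReductionAtPrime ℓ :=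
    fun ℓ _ h => (W.dvd_conductorNorm_iff_not_hasGoodReductionAtPrime ℓ).mp h
  have hbadB : ∀ (ℓ : ℕ) [Fact ℓ.Prime], ¬ W.HasGoodReductionAtPrime ℓ → ℓ ∣ W.conductorNorm ℤ :=
    fun ℓ _ h => (W.dvd_conductorNorm_iff_not_hasGoodReductionAtPrime ℓ).mpr h
  -- `e : ℚ̄_p ≃ ℂ`, `σ : K → ℂ`
  obtain ⟨e⟩ := PadicAlgCl.nonempty_ringEquiv_complex p
  let σ : K →+* ℂ := (IsAlgClosed.lift (R := ℚ) (M := ℂ) (S := K)).toRingHom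
  obtain ⟨𝔪, ψ, σ', h𝔪, hnop, hpD, hbad, hψG, hneb, htrace⟩ :=
    exists_arithmeticHalf_of_inertField W p Φ K hp2 hss e₀ he₀ hk h2 htr hGN hK2 hUle hKU hvp hgen hπ hq hcard ι c cO hcO hc hΔ hδ'
      hd4 hpd hdK (W.conductorNorm ℤ) hB0 hpB hBbad hbadB e σ
  exact ⟨K, inferInstance, inferInstance, σ', 𝔪, ψ, e, hK2, htc, h𝔪, hnop, hpD, (fun ℓ _ h => hbad ℓ h), hψG, hneb,
    (fun ℓ _ hℓp hgood => htrace ℓ hℓp hgood), ⟨v, hvp, hcard⟩, hpd, hdK, Φ, k, e₀, he₀, hk, h2, htr, hGN, hUle, hKU⟩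

end Summit.BirchSwinnertonDyer.BirchSwinnertonDyer.Theorems.SmallImageLambdaLowerThreeNsThetaPartner

end
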